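import Summits.HodgeConjecture.HodgeConjecture.Theorems.Ring2WeilCoverageCMFieldAllPrimesL
import Summits.HodgeConjecture.HodgeConjecture.Theorems.Ring2WeilCoverageCMFieldAllPrimesJ
import Summits.HodgeConjecture.HodgeConjecture.Theorems.Ring2WeilCoverageCMFieldAllPrimesF
import Mathlib.Data.Nat.Factorization.Basic
import HarnessLib

/-!
# Weil-type components over quartic CM fields, IX (part M): the INTEGER classes `[n]` from the prime
# classifications — `[n] = [1] ⟺ every non-split prime divides n to an even power`

research route conditional on HC_CM; not a corollary; Q11.4-sentence-2 already refuted in dim ≥ 3. Cell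
`pub-hodge-ring2`, seat `ring2-b03` (gen 52). Parts E/F/J/L decide, for the six Galois census fields `E = F(√σ)`
(`ℚ(ζ₅)`, `ℚ(ζ₈)`, `ℚ(ζ₁₂)`, `ℚ(√-3,√5)`, `ℚ(i,√5)`, `ℚ(√-(2+√2))`), the class `[ℓ] ∈ F^×/Nm_{E/F}(E^×)` of every rational
PRIME: `[ℓ] = [1]` on an explicit «split type» `S` and `[ℓ] ≠ [1]` off it; parts A/B/C/G give the stronger obstruction
`[ℓ·w] ≠ [1]` (`ℓ ∤ w`) off `S`. This part passes from primes to ALL POSITIVE INTEGERS `n` — the full list of rational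
rows `W8.E.[n]` of the census tables (gens 46–50 did `n ≤ 40` numeral by numeral):

* §1 GENERIC (any of Deligne's carriers `R`): from (a) `[ℓ] = [1]` for the primes of split type `S` and
  (b) `[ℓ·w] ≠ [1]` (`ℓ ∤ w`) for the primes off `S` — except possibly ONE prime `ℓ₀` off `S` for which only
  `[ℓ₀] ≠ [1]` is known (`ℓ₀ = 2` for `ℚ(ζ₅)`: the `(√5)`-adic obstruction of gen 47 is stated without cofactor) —:
  **`[n] = [1] ⟺ ∀ ℓ prime, ¬ S ℓ → Even (n.factorization ℓ)`** (`natCast_eq_split_iff_even`: ⇐ by peeling split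
  primes and squares, `[u·v²] = [u]`; ⇒ at an odd exponent `n = ℓ^{2j+1}·w`, `[ℓ·w] = [n] = [1]` contradicts (b), and at
  `ℓ₀` the cofactor `w` is split by ⇐, so `[ℓ₀] = [1]` contradicts `[ℓ₀] ≠ [1]`); and the row structure
  **`[n₁] = [n₂] ⟺ ∀ ℓ prime off S, n₁.factorization ℓ ≡ n₂.factorization ℓ (mod 2)`** (classes have order two:
  `[n₁] = [n₂] ⟺ [n₁·n₂] = [1]`);
* §2 the instance **`ℚ(√-(2+√2))`** (`R = S² + 4S + 2`, `S ℓ ⟺ ℓ = 2 ∨ ℓ % 16 ∈ {1, 7}`, no exceptional prime; parts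
  C/G/L), also with `R` literal;
* §3 the instance **`ℚ(ζ₅)`** (`R = S² + 5S + 5`, `S ℓ ⟺ ℓ = 5 ∨ ℓ % 5 = 1`, `ℓ₀ = 2`; gen 47, parts A/J).

So for these fields the rational rows of the census table are indexed by the finite sets of non-split primes
(`n ↦ {ℓ ∉ S : ℓ ∥^{odd} n}` is a complete invariant of `[n]`), each set occurring. No named fact, no definition,
no `sorry`; nothing about the Hodge conjecture is asserted (index-set structure only; the general member of every
row is OPEN). References: [Deligne1982HodgeCycles] §4 p. 30 (1), Cor. 4.2, Lemma 4.6; [Landherr1936HermitianForms]. -/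

noncomputable section

set_option linter.dupNamespace false

open Polynomial

namespace Summit.HodgeConjecture.HodgeConjecture.Ring2.WeilCoverageCM

open Literature.AlgebraicGeometry.Deligne1982
open Literature.AlgebraicGeometry.HodgeTheory (splitDiscriminantClassCM)

/-! ### §1 Generic: integer classes from a prime classification -/

section IntegerClasses

variable {R : Polynomial ℤ} [Fact (Irreducible (realPolyQ R))] [Fact (Irreducible (cmPolyQ R))]

omit [Fact (Irreducible (cmPolyQ R))] in
/-- `[1] = [1]`. [folklore] -/
theorem natCast_one_eq_split (v : (realField R)ˣ) (hv : (v : realField R) = ((1 : ℕ) : realField R)) :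
    (QuotientGroup.mk v : cmNormResidueGroup R) = splitDiscriminantClassCM R 2 := by
  have : v = 1 := Units.ext (by rw [hv, Nat.cast_one, Units.val_one])
  rw [this, QuotientGroup.mk_one, splitDiscriminantClassCM_two_eq_one]

omit [Fact (Irreducible (cmPolyQ R))] in
/-- `[a] = [b] = [1] ⇒ [a·b] = [1]` (classes of positive integers). [folklore] -/
theorem natCast_mul_eq_split (a b : ℕ) (ha : 1 ≤ a) (hb : 1 ≤ b)
    (hsa : ∀ v : (realField R)ˣ, (v : realField R) = a →
      (QuotientGroup.mk v : cmNormResidueGroup R) = splitDiscriminantClassCM R 2)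
    (hsb : ∀ v : (realField R)ˣ, (v : realField R) = b →
      (QuotientGroup.mk v : cmNormResidueGroup R) = splitDiscriminantClassCM R 2)
    (v : (realField R)ˣ) (hv : (v : realField R) = ((a * b : ℕ) : realField R)) :
    (QuotientGroup.mk v : cmNormResidueGroup R) = splitDiscriminantClassCM R 2 := by
  set ua : (realField R)ˣ := Units.mk0 (a : realField R) (natCast_ne_zero_realField a ha) with hua
  set ub : (realField R)ˣ := Units.mk0 (b : realField R) (natCast_ne_zero_realField b hb) with hub
  have : v = ua * ub := Units.ext (by rw [hv, Units.val_mul, hua, hub, Units.val_mk0, Units.val_mk0]; push_cast; rfl)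
  rw [this]
  exact mk_mul_eq_splitDiscriminantClassCM_two ua ub (hsa ua (Units.val_mk0 _)) (hsb ub (Units.val_mk0 _))

/-- `[b] = [1] ⇒ [a²·b] = [1]` (squares are norms). [folklore] -/
theorem natCast_sq_mul_eq_split (a b : ℕ) (ha : 1 ≤ a)
    (hsb : ∀ v : (realField R)ˣ, (v : realField R) = b →
      (QuotientGroup.mk v : cmNormResidueGroup R) = splitDiscriminantClassCM R 2)
    (v : (realField R)ˣ) (hv : (v : realField R) = ((a * a * b : ℕ) : realField R)) :
    (QuotientGroup.mk v : cmNormResidueGroup R) = splitDiscriminantClassCM R 2 := by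
  set ua : (realField R)ˣ := Units.mk0 (a : realField R) (natCast_ne_zero_realField a ha) with hua
  have hb' : ((v * (ua ^ 2)⁻¹ : (realField R)ˣ) : realField R) = b := by
    rw [Units.val_mul, Units.val_inv_eq_inv_val, Units.val_pow_eq_pow_val, hua, Units.val_mk0, hv]
    have ha0 : (a : realField R) ≠ 0 := natCast_ne_zero_realField a ha
    push_cast
    field_simp
  rw [show v = (v * (ua ^ 2)⁻¹) * ua ^ 2 by rw [inv_mul_cancel_right], mk_mul_sq_cmNormResidueGroup]
  exact hsb _ hb'

/-- **Integer classes, split direction.** If `[ℓ] = [1]` for every prime of split type `S`, then every `n ≥ 1` all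
of whose primes off `S` occur to EVEN powers has `[n] = [1]` (peel the least prime factor: a split prime is stripped
by multiplicativity, a non-split one occurs squared and `[u·v²] = [u]`). [cite: Deligne1982HodgeCycles, §4 p. 30 (1)
and Cor. 4.2] -/
theorem natCast_eq_split_of_even (S : ℕ → Prop)
    (hS : ∀ ℓ : ℕ, ℓ.Prime → S ℓ → ∀ v : (realField R)ˣ, (v : realField R) = ℓ →
      (QuotientGroup.mk v : cmNormResidueGroup R) = splitDiscriminantClassCM R 2)
    (n : ℕ) : 1 ≤ n → (∀ ℓ : ℕ, ℓ.Prime → ¬ S ℓ → Even (n.factorization ℓ)) →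
    ∀ v : (realField R)ˣ, (v : realField R) = n →
      (QuotientGroup.mk v : cmNormResidueGroup R) = splitDiscriminantClassCM R 2 := by
  classical
  induction n using Nat.strong_induction_on with
  | _ n ih =>
  intro hn heven v hv
  by_cases hn1 : n = 1
  · subst hn1
    exact natCast_one_eq_split v (by rw [hv])
  · have hn2 : 2 ≤ n := by omega
    have hn0 : n ≠ 0 := by omega
    set q := n.minFac with hqdef
    have hq : q.Prime := Nat.minFac_prime hn1
    have hq0 : q ≠ 0 := hq.ne_zero
    obtain ⟨n₁, hn₁⟩ : q ∣ n := Nat.minFac_dvd n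
    have hn₁0 : n₁ ≠ 0 := by rintro rfl; rw [mul_zero] at hn₁; exact hn0 hn₁
    have hn₁pos : 1 ≤ n₁ := Nat.one_le_iff_ne_zero.2 hn₁0
    have hn₁lt : n₁ < n := by rw [hn₁]; nlinarith [hq.two_le]
    have hfac : ∀ ℓ : ℕ, n.factorization ℓ = q.factorization ℓ + n₁.factorization ℓ := fun ℓ => by
      rw [hn₁, Nat.factorization_mul hq0 hn₁0, Finsupp.add_apply]
    by_cases hSq : S q
    · -- strip the split prime `q`
      have heven₁ : ∀ ℓ : ℕ, ℓ.Prime → ¬ S ℓ → Even (n₁.factorization ℓ) := by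
        intro ℓ hℓ hSℓ
        have hne : ℓ ≠ q := fun h => hSℓ (h ▸ hSq)
        have h0 : q.factorization ℓ = 0 :=
          Nat.factorization_eq_zero_of_not_dvd ((Nat.prime_dvd_prime_iff_eq hℓ hq).not.2 hne)
        have h := heven ℓ hℓ hSℓ
        rwa [hfac ℓ, h0, zero_add] at h
      exact natCast_mul_eq_split q n₁ hq.one_lt.le hn₁pos (hS q hq hSq) (ih n₁ hn₁lt hn₁pos heven₁) v
        (by rw [hv, hn₁])
    · -- `q` occurs to an even power `≥ 2`: strip `q²`
      have hq1 : q.factorization q = 1 := hq.factorization_self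
      have h2 : 2 ≤ n.factorization q := by
        obtain ⟨j, hj⟩ := heven q hq hSq
        have h1 : 1 ≤ n.factorization q := by rw [hfac q, hq1]; omega
        omega
      obtain ⟨n₂, hn₂⟩ : q ^ 2 ∣ n := (hq.pow_dvd_iff_le_factorization hn0).2 h2
      have hn₂0 : n₂ ≠ 0 := by rintro rfl; rw [mul_zero] at hn₂; exact hn0 hn₂
      have hn₂pos : 1 ≤ n₂ := Nat.one_le_iff_ne_zero.2 hn₂0
      have hn₂lt : n₂ < n := by rw [hn₂]; nlinarith [hq.two_le]
      have hfac₂ : ∀ ℓ : ℕ, n.factorization ℓ = 2 * q.factorization ℓ + n₂.factorization ℓ := fun ℓ => by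
        rw [hn₂, Nat.factorization_mul (pow_ne_zero 2 hq0) hn₂0, Finsupp.add_apply, Nat.factorization_pow,
          Finsupp.smul_apply, smul_eq_mul]
      have heven₂ : ∀ ℓ : ℕ, ℓ.Prime → ¬ S ℓ → Even (n₂.factorization ℓ) := by
        intro ℓ hℓ hSℓ
        have h := heven ℓ hℓ hSℓ
        rw [hfac₂ ℓ] at h
        exact (Nat.even_add.1 h).1 (even_two_mul _)
      exact natCast_sq_mul_eq_split q n₂ hq.one_lt.le (ih n₂ hn₂lt hn₂pos heven₂) v (by rw [hv, hn₂]; ring_nf)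

/-- From `[n] = [1]` and an odd exponent `n = ℓ^{2j+1}·w`: `[ℓ·w] = [1]` (strip the square `(ℓ^j)²`). [folklore] -/
theorem natCast_prime_mul_eq_split_of_odd (n ℓ w j : ℕ) (hn : ℓ ^ (2 * j + 1) * w = n) (hℓ1 : 1 ≤ ℓ)
    (hsplit : ∀ v : (realField R)ˣ, (v : realField R) = n →
      (QuotientGroup.mk v : cmNormResidueGroup R) = splitDiscriminantClassCM R 2)
    (v : (realField R)ˣ) (hv : (v : realField R) = ((ℓ * w : ℕ) : realField R)) :
    (QuotientGroup.mk v : cmNormResidueGroup R) = splitDiscriminantClassCM R 2 := by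
  refine natCast_split_of_sq_mul (ℓ ^ j) (ℓ * w) (Nat.one_le_pow _ _ hℓ1) (fun w' hw' => hsplit w' ?_) v hv
  rw [hw', ← hn]
  congr 1
  ring

/-- **Integer classes, obstruction direction.** If `[ℓ·w] ≠ [1]` (`ℓ ∤ w`) for every prime `ℓ` off the split type
`S` other than `ℓ₀`, `[ℓ₀] ≠ [1]` (if `ℓ₀` is a prime off `S`), and `[ℓ] = [1]` on `S`, then `[n] = [1]` forces every
prime off `S` to divide `n` to an EVEN power. [cite: Deligne1982HodgeCycles, §4 p. 30 (1) and Cor. 4.2] -/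
theorem even_factorization_of_natCast_eq_split (S : ℕ → Prop) (ℓ₀ : ℕ)
    (hS : ∀ ℓ : ℕ, ℓ.Prime → S ℓ → ∀ v : (realField R)ˣ, (v : realField R) = ℓ →
      (QuotientGroup.mk v : cmNormResidueGroup R) = splitDiscriminantClassCM R 2)
    (h₀ : ℓ₀.Prime → ¬ S ℓ₀ → ∀ v : (realField R)ˣ, (v : realField R) = ℓ₀ →
      (QuotientGroup.mk v : cmNormResidueGroup R) ≠ splitDiscriminantClassCM R 2)
    (hN : ∀ ℓ : ℕ, ℓ.Prime → ¬ S ℓ → ℓ ≠ ℓ₀ → ∀ w : ℤ, ¬ (ℓ : ℤ) ∣ w → ∀ v : (realField R)ˣ,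
      (v : realField R) = AdjoinRoot.of (realPolyQ R) (ℓ * w) →
      (QuotientGroup.mk v : cmNormResidueGroup R) ≠ splitDiscriminantClassCM R 2)
    (n : ℕ) (hn : 1 ≤ n) (v : (realField R)ˣ) (hv : (v : realField R) = n)
    (hsplit : (QuotientGroup.mk v : cmNormResidueGroup R) = splitDiscriminantClassCM R 2) :
    ∀ ℓ : ℕ, ℓ.Prime → ¬ S ℓ → Even (n.factorization ℓ) := by
  classical
  have hn0 : n ≠ 0 := by omega
  have hsplit' : ∀ w : (realField R)ˣ, (w : realField R) = n →
      (QuotientGroup.mk w : cmNormResidueGroup R) = splitDiscriminantClassCM R 2 := fun w hw => by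
    rwa [show w = v from Units.ext (hw.trans hv.symm)]
  -- the key step at a prime `ℓ ≠ ℓ₀` off `S`
  -- `n = ℓ^e · w₀`, `ℓ ∤ w₀` (`w₀ = ordCompl[ℓ] n`, kept opaque)
  have hdec : ∀ ℓ : ℕ, ℓ.Prime → ∃ w₀ : ℕ, ℓ ^ n.factorization ℓ * w₀ = n ∧ ¬ ℓ ∣ w₀ ∧ 1 ≤ w₀ ∧
      (∀ ℓ' : ℕ, ℓ' ≠ ℓ → w₀.factorization ℓ' = n.factorization ℓ') ∧ w₀.factorization ℓ = 0 := fun ℓ hℓ =>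
    ⟨n / ℓ ^ n.factorization ℓ, Nat.ordProj_mul_ordCompl_eq_self n ℓ, Nat.not_dvd_ordCompl hℓ hn0,
      Nat.ordCompl_pos ℓ hn0, fun ℓ' h' => by rw [Nat.factorization_ordCompl n ℓ, Finsupp.erase_ne h'],
      by rw [Nat.factorization_ordCompl n ℓ, Finsupp.erase_same]⟩
  -- at an odd exponent: `[ℓ·w₀] = [1]`
  have hodd_split : ∀ ℓ w₀ : ℕ, ℓ.Prime → ℓ ^ n.factorization ℓ * w₀ = n → ¬ Even (n.factorization ℓ) →
      ∀ u : (realField R)ˣ, (u : realField R) = ((ℓ * w₀ : ℕ) : realField R) →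
      (QuotientGroup.mk u : cmNormResidueGroup R) = splitDiscriminantClassCM R 2 := by
    intro ℓ w₀ hℓ hw₀ hodd u hu
    obtain ⟨j, hj⟩ := Nat.not_even_iff_odd.1 hodd
    rw [hj] at hw₀
    exact natCast_prime_mul_eq_split_of_odd n ℓ w₀ j hw₀ hℓ.one_lt.le hsplit' u hu
  -- the key step at a prime `ℓ ≠ ℓ₀` off `S`
  have key : ∀ ℓ : ℕ, ℓ.Prime → ¬ S ℓ → ℓ ≠ ℓ₀ → Even (n.factorization ℓ) := by
    intro ℓ hℓ hSℓ hne
    by_contra hodd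
    obtain ⟨w₀, hw₀, hndvd, hw₀pos, -, -⟩ := hdec ℓ hℓ
    have hw : ¬ (ℓ : ℤ) ∣ (w₀ : ℤ) := fun h => hndvd (by exact_mod_cast h)
    have hpos : 1 ≤ ℓ * w₀ := Nat.mul_le_mul hℓ.one_lt.le hw₀pos
    set u : (realField R)ˣ := Units.mk0 (((ℓ * w₀ : ℕ)) : realField R) (natCast_ne_zero_realField _ hpos) with hu
    have h1 := hodd_split ℓ w₀ hℓ hw₀ hodd u (Units.val_mk0 _)
    exact hN ℓ hℓ hSℓ hne (w₀ : ℤ) hw u (by rw [hu, Units.val_mk0]; push_cast; simp only [map_mul, map_natCast]) h1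
  intro ℓ hℓ hSℓ
  by_cases hne : ℓ = ℓ₀
  · subst hne
    by_contra hodd
    -- the cofactor `w₀` has all primes off `S` to even powers, so `[w₀] = [1]`; then `[ℓ] = [1]`
    obtain ⟨w₀, hw₀, -, hw₀pos, hfac', hfac0⟩ := hdec ℓ hℓ
    have hwfac : ∀ ℓ' : ℕ, ℓ'.Prime → ¬ S ℓ' → Even (w₀.factorization ℓ') := by
      intro ℓ' hℓ' hSℓ'
      by_cases h' : ℓ' = ℓ
      · rw [h', hfac0]; exact Even.zero
      · rw [hfac' ℓ' h']; exact key ℓ' hℓ' hSℓ' h'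
    have hw1 := natCast_eq_split_of_even S hS w₀ hw₀pos hwfac
    have hℓw := hodd_split ℓ w₀ hℓ hw₀ hodd
    set u : (realField R)ˣ := Units.mk0 ((ℓ : ℕ) : realField R) (natCast_ne_zero_realField _ hℓ.one_lt.le) with hu
    refine h₀ hℓ hSℓ u (Units.val_mk0 _) ?_
    refine natCast_split_of_mul_of_left w₀ ℓ hw₀pos hw1 (fun w hw => hℓw w ?_) u (Units.val_mk0 _)
    rw [hw, mul_comm]
  · exact key ℓ hℓ hSℓ hne

/-- **INTEGER CLASSES: `[n] = [1] ⟺ every prime off the split type divides `n` to an even power`** (`n ≥ 1`), from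
a prime classification `S` with cofactor obstructions off `S` (one exceptional prime `ℓ₀` allowed).
[cite: Deligne1982HodgeCycles, §4 p. 30 (1) and Cor. 4.2] [cite: Landherr1936HermitianForms] -/
theorem natCast_eq_split_iff_even (S : ℕ → Prop) (ℓ₀ : ℕ)
    (hS : ∀ ℓ : ℕ, ℓ.Prime → S ℓ → ∀ v : (realField R)ˣ, (v : realField R) = ℓ →
      (QuotientGroup.mk v : cmNormResidueGroup R) = splitDiscriminantClassCM R 2)
    (h₀ : ℓ₀.Prime → ¬ S ℓ₀ → ∀ v : (realField R)ˣ, (v : realField R) = ℓ₀ →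
      (QuotientGroup.mk v : cmNormResidueGroup R) ≠ splitDiscriminantClassCM R 2)
    (hN : ∀ ℓ : ℕ, ℓ.Prime → ¬ S ℓ → ℓ ≠ ℓ₀ → ∀ w : ℤ, ¬ (ℓ : ℤ) ∣ w → ∀ v : (realField R)ˣ,
      (v : realField R) = AdjoinRoot.of (realPolyQ R) (ℓ * w) →
      (QuotientGroup.mk v : cmNormResidueGroup R) ≠ splitDiscriminantClassCM R 2)
    (n : ℕ) (hn : 1 ≤ n) (v : (realField R)ˣ) (hv : (v : realField R) = n) :
    (QuotientGroup.mk v : cmNormResidueGroup R) = splitDiscriminantClassCM R 2 ↔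
      ∀ ℓ : ℕ, ℓ.Prime → ¬ S ℓ → Even (n.factorization ℓ) :=
  ⟨even_factorization_of_natCast_eq_split S ℓ₀ hS h₀ hN n hn v hv,
    fun h => natCast_eq_split_of_even S hS n hn h v hv⟩

/-- **ROW STRUCTURE: `[n₁] = [n₂] ⟺ the primes off the split type occur in `n₁` and `n₂` with exponents of the same
parity`** (classes have order two, so `[n₁] = [n₂] ⟺ [n₁·n₂] = [1]`). [cite: Deligne1982HodgeCycles, §4 p. 30 (1)
and Cor. 4.2] [cite: Landherr1936HermitianForms] -/
theorem natCast_mk_eq_mk_iff_even (S : ℕ → Prop) (ℓ₀ : ℕ)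
    (hS : ∀ ℓ : ℕ, ℓ.Prime → S ℓ → ∀ v : (realField R)ˣ, (v : realField R) = ℓ →
      (QuotientGroup.mk v : cmNormResidueGroup R) = splitDiscriminantClassCM R 2)
    (h₀ : ℓ₀.Prime → ¬ S ℓ₀ → ∀ v : (realField R)ˣ, (v : realField R) = ℓ₀ →
      (QuotientGroup.mk v : cmNormResidueGroup R) ≠ splitDiscriminantClassCM R 2)
    (hN : ∀ ℓ : ℕ, ℓ.Prime → ¬ S ℓ → ℓ ≠ ℓ₀ → ∀ w : ℤ, ¬ (ℓ : ℤ) ∣ w → ∀ v : (realField R)ˣ,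
      (v : realField R) = AdjoinRoot.of (realPolyQ R) (ℓ * w) →
      (QuotientGroup.mk v : cmNormResidueGroup R) ≠ splitDiscriminantClassCM R 2)
    {n₁ n₂ : ℕ} (hn₁ : 1 ≤ n₁) (hn₂ : 1 ≤ n₂) (u v : (realField R)ˣ) (hu : (u : realField R) = n₁)
    (hv : (v : realField R) = n₂) :
    (QuotientGroup.mk u : cmNormResidueGroup R) = QuotientGroup.mk v ↔
      ∀ ℓ : ℕ, ℓ.Prime → ¬ S ℓ → (Even (n₁.factorization ℓ) ↔ Even (n₂.factorization ℓ)) := by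
  have hn₁0 : n₁ ≠ 0 := by omega
  have hn₂0 : n₂ ≠ 0 := by omega
  -- `[u] = [v] ⟺ [u·v] = [1]`
  have huv : (QuotientGroup.mk u : cmNormResidueGroup R) = QuotientGroup.mk v ↔
      (QuotientGroup.mk (u * v) : cmNormResidueGroup R) = splitDiscriminantClassCM R 2 := by
    have hv2 : (QuotientGroup.mk v : cmNormResidueGroup R) * QuotientGroup.mk v = 1 := by
      rw [← QuotientGroup.mk_mul, ← sq, QuotientGroup.eq_one_iff]
      exact sq_mem_normUnitsSubgroup_cmField v
    rw [splitDiscriminantClassCM_two_eq_one, QuotientGroup.mk_mul, mul_eq_one_iff_eq_inv,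
      inv_eq_of_mul_eq_one_right hv2]
  rw [huv, natCast_eq_split_iff_even S ℓ₀ hS h₀ hN (n₁ * n₂) (Nat.mul_le_mul hn₁ hn₂) (u * v)
    (by rw [Units.val_mul, hu, hv]; push_cast; ring)]
  refine forall_congr' fun ℓ => forall_congr' fun _ => forall_congr' fun _ => ?_
  rw [Nat.factorization_mul hn₁0 hn₂0, Finsupp.add_apply, Nat.even_add]

end IntegerClasses

/-! ### §2 The instance `ℚ(√-(2+√2))` -/

section SqrtNegTwoPlusSqrtTwo

variable {R : Polynomial ℤ} (hR : R = X ^ 2 + C 4 * X + C 2) [Fact (Irreducible (realPolyQ R))]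
include hR

/-- **`ℚ(√-(2+√2))`: `[n] = [1] ⟺ every prime `ℓ ≠ 2`, `ℓ % 16 ∉ {1, 7}` divides `n` to an even power** (`n ≥ 1`) —
all rational rows of the sixth census table at once (gens 46–50: `n ≤ 40`). [cite: Deligne1982HodgeCycles, §4 p. 30
(1) and Cor. 4.2] [cite: Landherr1936HermitianForms] -/
theorem sqrtNegTwoPlusSqrtTwo_natCast_eq_split_iff (n : ℕ) (hn : 1 ≤ n) (v : (realField R)ˣ)
    (hv : (v : realField R) = n) :
    (QuotientGroup.mk v : cmNormResidueGroup R) = splitDiscriminantClassCM R 2 ↔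
      ∀ ℓ : ℕ, ℓ.Prime → ¬ (ℓ = 2 ∨ ℓ % 16 = 1 ∨ ℓ % 16 = 7) → Even (n.factorization ℓ) := by
  haveI := fact_irreducible_cmPolyQ_sqrtNegTwoPlusSqrtTwo hR
  refine natCast_eq_split_iff_even (fun ℓ => ℓ = 2 ∨ ℓ % 16 = 1 ∨ ℓ % 16 = 7) 1
    (fun ℓ hℓ hs => sqrtNegTwoPlusSqrtTwo_mk_prime_eq_splitDiscriminantClassCM_of_splitType hR ℓ hℓ hs)
    (fun h => absurd h Nat.not_prime_one) ?_ n hn v hv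
  intro ℓ hℓ hs _ w hw u hu
  exact sqrtNegTwoPlusSqrtTwo_mk_prime_mul_ne_splitDiscriminantClassCM_of_mod_sixteen_ne hR ℓ hℓ
    (fun h => hs (Or.inl h)) (fun h => hs (Or.inr (Or.inl h))) (fun h => hs (Or.inr (Or.inr h))) w hw u hu

/-- **`ℚ(√-(2+√2))`: `[n₁] = [n₂] ⟺ every prime `ℓ ≠ 2`, `ℓ % 16 ∉ {1, 7}` occurs in `n₁`, `n₂` with exponents of
the same parity** — the complete row structure of the rational rows. [cite: Deligne1982HodgeCycles, §4 p. 30 (1) and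
Cor. 4.2] [cite: Landherr1936HermitianForms] -/
theorem sqrtNegTwoPlusSqrtTwo_natCast_mk_eq_mk_iff {n₁ n₂ : ℕ} (hn₁ : 1 ≤ n₁) (hn₂ : 1 ≤ n₂)
    (u v : (realField R)ˣ) (hu : (u : realField R) = n₁) (hv : (v : realField R) = n₂) :
    (QuotientGroup.mk u : cmNormResidueGroup R) = QuotientGroup.mk v ↔
      ∀ ℓ : ℕ, ℓ.Prime → ¬ (ℓ = 2 ∨ ℓ % 16 = 1 ∨ ℓ % 16 = 7) →
        (Even (n₁.factorization ℓ) ↔ Even (n₂.factorization ℓ)) := by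
  haveI := fact_irreducible_cmPolyQ_sqrtNegTwoPlusSqrtTwo hR
  refine natCast_mk_eq_mk_iff_even (fun ℓ => ℓ = 2 ∨ ℓ % 16 = 1 ∨ ℓ % 16 = 7) 1
    (fun ℓ hℓ hs => sqrtNegTwoPlusSqrtTwo_mk_prime_eq_splitDiscriminantClassCM_of_splitType hR ℓ hℓ hs)
    (fun h => absurd h Nat.not_prime_one) ?_ hn₁ hn₂ u v hu hv
  intro ℓ hℓ hs _ w hw u hu
  exact sqrtNegTwoPlusSqrtTwo_mk_prime_mul_ne_splitDiscriminantClassCM_of_mod_sixteen_ne hR ℓ hℓ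
    (fun h => hs (Or.inl h)) (fun h => hs (Or.inr (Or.inl h))) (fun h => hs (Or.inr (Or.inr h))) w hw u hu

end SqrtNegTwoPlusSqrtTwo

/-! ### §3 The instance `ℚ(ζ₅)` (exceptional prime `ℓ₀ = 2`) -/

section Zeta5

variable {R : Polynomial ℤ} (hR : R = X ^ 2 + C 5 * X + C 5) [Fact (Irreducible (realPolyQ R))]
include hR

/-- **`ℚ(ζ₅)`: `[n] = [1] ⟺ every prime `ℓ ≠ 5`, `ℓ % 5 ≠ 1` divides `n` to an even power** (`n ≥ 1`; the split
type is `ℓ = 5 ∨ ℓ ≡ 1 (mod 5)`, part J; cofactor obstructions for the odd primes `ℓ ≡ 2, 3, 4 (mod 5)`, part A; at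
`ℓ₀ = 2` gen 47's `(√5)`-adic `[2] ≠ [1]`). [cite: Deligne1982HodgeCycles, §4 p. 30 (1) and Cor. 4.2]
[cite: Landherr1936HermitianForms] -/
theorem zeta5_natCast_eq_split_iff (n : ℕ) (hn : 1 ≤ n) (v : (realField R)ˣ) (hv : (v : realField R) = n) :
    (QuotientGroup.mk v : cmNormResidueGroup R) = splitDiscriminantClassCM R 2 ↔
      ∀ ℓ : ℕ, ℓ.Prime → ¬ (ℓ = 5 ∨ ℓ % 5 = 1) → Even (n.factorization ℓ) := by
  haveI := fact_irreducible_cmPolyQ_of_pos hR (by norm_num) (by norm_num) disc_not_sq_five_five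
  refine natCast_eq_split_iff_even (fun ℓ => ℓ = 5 ∨ ℓ % 5 = 1) 2 ?_ ?_ ?_ n hn v hv
  · intro ℓ hℓ hs u hu
    by_contra hne
    obtain ⟨h1, h5⟩ := (zeta5_mk_prime_ne_splitDiscriminantClassCM_iff hR ℓ hℓ u hu).1 hne
    rcases hs with h | h
    · exact h5 h
    · exact h1 h
  · intro _ _ u hu
    exact (zeta5_mk_prime_ne_splitDiscriminantClassCM_iff hR 2 Nat.prime_two u hu).2 ⟨by norm_num, by norm_num⟩
  · intro ℓ hℓ hs h2 w hw u hu
    have h5 : ℓ % 5 ≠ 0 := fun h => by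
      have : 5 ∣ ℓ := Nat.dvd_of_mod_eq_zero h
      rcases (Nat.dvd_prime hℓ).1 this with h' | h'
      · omega
      · exact hs (Or.inl h'.symm)
    exact zeta5_mk_prime_mul_ne_splitDiscriminantClassCM_of_mod_five hR ℓ hℓ h2
      (by have := fun h => hs (Or.inr h); omega) w hw u hu

/-- **`ℚ(ζ₅)`: `[n₁] = [n₂] ⟺ every prime `ℓ ≠ 5`, `ℓ % 5 ≠ 1` occurs in `n₁`, `n₂` with exponents of the same
parity.** [cite: Deligne1982HodgeCycles, §4 p. 30 (1) and Cor. 4.2] [cite: Landherr1936HermitianForms] -/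
theorem zeta5_natCast_mk_eq_mk_iff {n₁ n₂ : ℕ} (hn₁ : 1 ≤ n₁) (hn₂ : 1 ≤ n₂) (u v : (realField R)ˣ)
    (hu : (u : realField R) = n₁) (hv : (v : realField R) = n₂) :
    (QuotientGroup.mk u : cmNormResidueGroup R) = QuotientGroup.mk v ↔
      ∀ ℓ : ℕ, ℓ.Prime → ¬ (ℓ = 5 ∨ ℓ % 5 = 1) → (Even (n₁.factorization ℓ) ↔ Even (n₂.factorization ℓ)) := by
  haveI := fact_irreducible_cmPolyQ_of_pos hR (by norm_num) (by norm_num) disc_not_sq_five_five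
  refine natCast_mk_eq_mk_iff_even (fun ℓ => ℓ = 5 ∨ ℓ % 5 = 1) 2 ?_ ?_ ?_ hn₁ hn₂ u v hu hv
  · intro ℓ hℓ hs u hu
    by_contra hne
    obtain ⟨h1, h5⟩ := (zeta5_mk_prime_ne_splitDiscriminantClassCM_iff hR ℓ hℓ u hu).1 hne
    rcases hs with h | h
    · exact h5 h
    · exact h1 h
  · intro _ _ u hu
    exact (zeta5_mk_prime_ne_splitDiscriminantClassCM_iff hR 2 Nat.prime_two u hu).2 ⟨by norm_num, by norm_num⟩
  · intro ℓ hℓ hs h2 w hw u hu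
    exact zeta5_mk_prime_mul_ne_splitDiscriminantClassCM_of_mod_five hR ℓ hℓ h2
      (by
        have h5 : ℓ % 5 ≠ 0 := fun h => by
          have : 5 ∣ ℓ := Nat.dvd_of_mod_eq_zero h
          rcases (Nat.dvd_prime hℓ).1 this with h' | h'
          · omega
          · exact hs (Or.inl h'.symm)
        have := fun h => hs (Or.inr h); omega) w hw u hu

end Zeta5

/-! ### §4 `R` literal -/

/-- **`ℚ(√-(2+√2))` (`R = S² + 4S + 2` literally): for every `n ≥ 1`, `[n] = [1] ⟺ every prime `ℓ ≠ 2`,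
`ℓ % 16 ∉ {1, 7}` divides `n` to an even power.** [cite: Deligne1982HodgeCycles, §4 p. 30 (1) and Cor. 4.2]
[cite: Landherr1936HermitianForms] -/
theorem sqrtNegTwoPlusSqrtTwo_integer_classification (n : ℕ) (hn : 1 ≤ n) :
    haveI := fact_irreducible_realPolyQ_of_not_sq (R := X ^ 2 + C 4 * X + C 2) rfl disc_not_sq_four_two
    ∀ v : (realField (X ^ 2 + C 4 * X + C 2))ˣ, (v : realField (X ^ 2 + C 4 * X + C 2)) = n →
      ((QuotientGroup.mk v : cmNormResidueGroup (X ^ 2 + C 4 * X + C 2)) =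
          splitDiscriminantClassCM (X ^ 2 + C 4 * X + C 2) 2 ↔
        ∀ ℓ : ℕ, ℓ.Prime → ¬ (ℓ = 2 ∨ ℓ % 16 = 1 ∨ ℓ % 16 = 7) → Even (n.factorization ℓ)) := by
  haveI := fact_irreducible_realPolyQ_of_not_sq (R := X ^ 2 + C 4 * X + C 2) rfl disc_not_sq_four_two
  exact fun v hv => sqrtNegTwoPlusSqrtTwo_natCast_eq_split_iff rfl n hn v hv

end Summit.HodgeConjecture.HodgeConjecture.Ring2.WeilCoverageCM

end
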